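import Summits.CriticalPhenomena.PercolationContinuityZ3.Theorems.PercNearOneGluingNoHeavyLowerTailSahiLatinZeroBottomPsi
import Summits.CriticalPhenomena.PercolationContinuityZ3.Theorems.PercNearOneGluingNoHeavyLowerTailSahiLatinCylinder

/-!
# `NoHeavyLowerTail` (crux stmt-CriticalPhenomena-4575), Sahi programme (prim-master-conj gen 49): ONE-COORDINATE PEELING of the four grid parts
# `cSS, cSO, cOS, cOO` of the zero-bottom functional `Ψ` — the exact section identities for a FREE coordinate and for a PRIMED literal
# coordinate (`I′` or `J′`, threshold `1` or `2`)

Support file (`--supports stmt-CriticalPhenomena-4575`; pure identities, no definitions, no `sorry`).  Memo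
`run/shared/lean/prim/prim-l12/FROM-prim-master-conj-g49-PEELING-THEOREM.md` §2.  Nothing here asserts the crux, Kahn's conjecture or (C¼).

THE MATHEMATICS.  An instance `(F; P, b, Q, c)` on `[3]^κ` (zero-bottom data: `b = P′∖P`, `c = Q′∖Q`) is LIFTED to `[3]^{Option κ}` by adding one
coordinate (the axis `none`) of a given type, the new `F` being an arbitrary set with sections `F₀ ⊆ F₁ ⊆ F₂` (`ofSections F₀ F₁ F₂`):
* FREE coordinate: all four sets become cylinders `ofSections X X X`;
* `I′`-LITERAL of threshold `2` (the literal `x_none = 2` belongs to `P` and to `P′`): `P ↦ ofSections ∅ ∅ P`, `b ↦ ofSections ∅ ∅ b`, `Q, c` cylinders;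
  threshold `1` (`x_none ≥ 1`): `P ↦ ofSections ∅ P P`, `b ↦ ofSections ∅ b b`;
* `J′`-LITERAL: the same with the roles of `(P,b)` and `(Q,c)` exchanged.
THEOREMS (every `κ`, arbitrary finsets): each grid part of the lifted instance is an explicit combination of the same part on the sections —
with LEVEL WEIGHTS `(0,0,2)` for the parts whose `P/b`-carrier is the `F`-point (`cSS`, `cSO`) and `(1,1,0)` for the others (`cOS`, `cOO`) under an
`I′`-literal of threshold `2`; `(0,2,2)` / `(2,1,1)` for threshold `1`; the same with `(cSS,cOS)` / `(cSO,cOO)` under a `J′`-literal; `(2,2,2)` for a free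
coordinate.  E.g. `cOS(lift) = cOS(F₀;…) + cOS(F₁;…)` and `cSS(lift) = 2·cSS(F₂;…)` (`I′`, threshold 2).  These are the transfer identities behind the
PAIRING LEMMA of the memo (§3): the 4-set grid inequality `cSS(H_SS)+cSO(H_SO)+cOS(H_OS)+cOO(H_OO) ≥ 0` reproduces itself when such a coordinate is
added.  Proofs: the letter expansions `S1_option`, `latinPairs_option`, `latinTriples_option` of `…SahiLatinSections` written out over the six
letters, the sections of `ofSections`, and `ring`.  Axioms standard. [this work]
-/

namespace Summit.CriticalPhenomena.PercolationContinuityZ3.Theorems.SahiLatin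

open Finset

variable {κ : Type*} [Fintype κ] [DecidableEq κ]

/-! ## §1  The letter expansions written out -/

/-- `S1` over `[3]^{Option κ}` as the three section terms. [this work] -/
theorem S1_option3 (s : Finset (Pt (Option κ))) : S1 s = 2 * (S1 (sec s 0) + S1 (sec s 1) + S1 (sec s 2)) := by
  rw [S1_option, Fin.sum_univ_three]

/-- `latinPairs` over `[3]^{Option κ}` as the six letter terms. [this work] -/
theorem latinPairs_option6 (s t : Finset (Pt (Option κ))) :
    latinPairs s t = latinPairs (sec s 0) (sec t 1) + latinPairs (sec s 0) (sec t 2) + latinPairs (sec s 1) (sec t 0)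
      + latinPairs (sec s 1) (sec t 2) + latinPairs (sec s 2) (sec t 0) + latinPairs (sec s 2) (sec t 1) := by
  rw [latinPairs_option, sum_perm3 (fun i j _ => latinPairs (sec s i) (sec t j))]

/-- `latinTriples` over `[3]^{Option κ}` as the six letter terms. [this work] -/
theorem latinTriples_option6 (s t v : Finset (Pt (Option κ))) :
    latinTriples s t v = latinTriples (sec s 0) (sec t 1) (sec v 2) + latinTriples (sec s 0) (sec t 2) (sec v 1)
      + latinTriples (sec s 1) (sec t 0) (sec v 2) + latinTriples (sec s 1) (sec t 2) (sec v 0)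
      + latinTriples (sec s 2) (sec t 0) (sec v 1) + latinTriples (sec s 2) (sec t 1) (sec v 0) := by
  rw [latinTriples_option, sum_perm3 (fun i j k => latinTriples (sec s i) (sec t j) (sec v k))]

/-- `latinTriples s ∅ v = 0`. [this work] -/
@[simp] theorem latinTriples_empty_second (s v : Finset (Pt κ)) : latinTriples s ∅ v = 0 := by simp [latinTriples]

/-- `latinTriples ∅ t v = 0`. [this work] -/
@[simp] theorem latinTriples_empty_first (t v : Finset (Pt κ)) : latinTriples ∅ t v = 0 := by simp [latinTriples]

/-! ## §2  Lift by a FREE coordinate (all sets cylinders) -/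

/-- Peeling a FREE coordinate (all sets cylinders): weights `(2,2,2)`: the part `cSS`, weights `(2, 2, 2)`. [this work] -/
theorem cSS_free (F0 F1 F2 P b Q c : Finset (Pt κ)) :
    cSS (ofSections F0 F1 F2) (ofSections P P P) (ofSections b b b) (ofSections Q Q Q) (ofSections c c c) =
      2 * cSS F0 P b Q c + 2 * cSS F1 P b Q c + 2 * cSS F2 P b Q c := by
  unfold cSS
  simp only [S1_option3, sec_inter, sec_ofSections_zero, sec_ofSections_one, sec_ofSections_two]
  ring

/-- Peeling a FREE coordinate (all sets cylinders): weights `(2,2,2)`: the part `cSO`, weights `(2, 2, 2)`. [this work] -/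
theorem cSO_free (F0 F1 F2 P b Q c : Finset (Pt κ)) :
    cSO (ofSections F0 F1 F2) (ofSections P P P) (ofSections b b b) (ofSections Q Q Q) (ofSections c c c) =
      2 * cSO F0 P b Q c + 2 * cSO F1 P b Q c + 2 * cSO F2 P b Q c := by
  unfold cSO
  simp only [latinPairs_option6, sec_inter, sec_ofSections_zero, sec_ofSections_one, sec_ofSections_two]
  ring

/-- Peeling a FREE coordinate (all sets cylinders): weights `(2,2,2)`: the part `cOS`, weights `(2, 2, 2)`. [this work] -/
theorem cOS_free (F0 F1 F2 P b Q c : Finset (Pt κ)) :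
    cOS (ofSections F0 F1 F2) (ofSections P P P) (ofSections b b b) (ofSections Q Q Q) (ofSections c c c) =
      2 * cOS F0 P b Q c + 2 * cOS F1 P b Q c + 2 * cOS F2 P b Q c := by
  unfold cOS
  simp only [latinPairs_option6, sec_inter, sec_ofSections_zero, sec_ofSections_one, sec_ofSections_two]
  ring

/-- Peeling a FREE coordinate (all sets cylinders): weights `(2,2,2)`: the part `cOO`, weights `(2, 2, 2)`. [this work] -/
theorem cOO_free (F0 F1 F2 P b Q c : Finset (Pt κ)) :
    cOO (ofSections F0 F1 F2) (ofSections P P P) (ofSections b b b) (ofSections Q Q Q) (ofSections c c c) =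
      2 * cOO F0 P b Q c + 2 * cOO F1 P b Q c + 2 * cOO F2 P b Q c := by
  unfold cOO
  simp only [latinPairs_option6, latinTriples_option6, sec_inter, sec_ofSections_zero, sec_ofSections_one, sec_ofSections_two]
  ring

/-! ## §3  Lift by an `I′`-literal of threshold `2` (`P ↦ ofSections ∅ ∅ P`, `b ↦ ofSections ∅ ∅ b`; `Q, c` cylinders) -/

/-- Peeling an `I′`-literal of threshold `2` (`P ↦ ofSections ∅ ∅ P`, `b ↦ ofSections ∅ ∅ b`; `Q, c` cylinders): weights `(0,0,2)` for `cSS, cSO`, `(1,1,0)` for `cOS, cOO`: the part `cSS`, weights `(0, 0, 2)`. [this work] -/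
theorem cSS_primeP_two (F0 F1 F2 P b Q c : Finset (Pt κ)) :
    cSS (ofSections F0 F1 F2) (ofSections ∅ ∅ P) (ofSections ∅ ∅ b) (ofSections Q Q Q) (ofSections c c c) =
      2 * cSS F2 P b Q c := by
  unfold cSS
  simp only [S1_option3, sec_inter, sec_ofSections_zero, sec_ofSections_one, sec_ofSections_two, inter_empty, empty_inter, S1_empty]
  ring

/-- Peeling an `I′`-literal of threshold `2` (`P ↦ ofSections ∅ ∅ P`, `b ↦ ofSections ∅ ∅ b`; `Q, c` cylinders): weights `(0,0,2)` for `cSS, cSO`, `(1,1,0)` for `cOS, cOO`: the part `cSO`, weights `(0, 0, 2)`. [this work] -/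
theorem cSO_primeP_two (F0 F1 F2 P b Q c : Finset (Pt κ)) :
    cSO (ofSections F0 F1 F2) (ofSections ∅ ∅ P) (ofSections ∅ ∅ b) (ofSections Q Q Q) (ofSections c c c) =
      2 * cSO F2 P b Q c := by
  unfold cSO
  simp only [latinPairs_option6, sec_inter, sec_ofSections_zero, sec_ofSections_one, sec_ofSections_two, inter_empty, latinPairs_empty_left]
  ring

/-- Peeling an `I′`-literal of threshold `2` (`P ↦ ofSections ∅ ∅ P`, `b ↦ ofSections ∅ ∅ b`; `Q, c` cylinders): weights `(0,0,2)` for `cSS, cSO`, `(1,1,0)` for `cOS, cOO`: the part `cOS`, weights `(1, 1, 0)`. [this work] -/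
theorem cOS_primeP_two (F0 F1 F2 P b Q c : Finset (Pt κ)) :
    cOS (ofSections F0 F1 F2) (ofSections ∅ ∅ P) (ofSections ∅ ∅ b) (ofSections Q Q Q) (ofSections c c c) =
      cOS F0 P b Q c + cOS F1 P b Q c := by
  unfold cOS
  simp only [latinPairs_option6, sec_inter, sec_ofSections_zero, sec_ofSections_one, sec_ofSections_two, latinPairs_empty_right]
  ring

/-- Peeling an `I′`-literal of threshold `2` (`P ↦ ofSections ∅ ∅ P`, `b ↦ ofSections ∅ ∅ b`; `Q, c` cylinders): weights `(0,0,2)` for `cSS, cSO`, `(1,1,0)` for `cOS, cOO`: the part `cOO`, weights `(1, 1, 0)`. [this work] -/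
theorem cOO_primeP_two (F0 F1 F2 P b Q c : Finset (Pt κ)) :
    cOO (ofSections F0 F1 F2) (ofSections ∅ ∅ P) (ofSections ∅ ∅ b) (ofSections Q Q Q) (ofSections c c c) =
      cOO F0 P b Q c + cOO F1 P b Q c := by
  unfold cOO
  simp only [latinPairs_option6, latinTriples_option6, sec_inter, sec_ofSections_zero, sec_ofSections_one, sec_ofSections_two, inter_empty, empty_inter, latinPairs_empty_right, latinTriples_empty_second]
  ring

/-! ## §4  Lift by an `I′`-literal of threshold `1` (`P ↦ ofSections ∅ P P`, `b ↦ ofSections ∅ b b`) -/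

/-- Peeling an `I′`-literal of threshold `1` (`P ↦ ofSections ∅ P P`, `b ↦ ofSections ∅ b b`): weights `(0,2,2)` for `cSS, cSO`, `(2,1,1)` for `cOS, cOO`: the part `cSS`, weights `(0, 2, 2)`. [this work] -/
theorem cSS_primeP_one (F0 F1 F2 P b Q c : Finset (Pt κ)) :
    cSS (ofSections F0 F1 F2) (ofSections ∅ P P) (ofSections ∅ b b) (ofSections Q Q Q) (ofSections c c c) =
      2 * cSS F1 P b Q c + 2 * cSS F2 P b Q c := by
  unfold cSS
  simp only [S1_option3, sec_inter, sec_ofSections_zero, sec_ofSections_one, sec_ofSections_two, inter_empty, empty_inter, S1_empty]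
  ring

/-- Peeling an `I′`-literal of threshold `1` (`P ↦ ofSections ∅ P P`, `b ↦ ofSections ∅ b b`): weights `(0,2,2)` for `cSS, cSO`, `(2,1,1)` for `cOS, cOO`: the part `cSO`, weights `(0, 2, 2)`. [this work] -/
theorem cSO_primeP_one (F0 F1 F2 P b Q c : Finset (Pt κ)) :
    cSO (ofSections F0 F1 F2) (ofSections ∅ P P) (ofSections ∅ b b) (ofSections Q Q Q) (ofSections c c c) =
      2 * cSO F1 P b Q c + 2 * cSO F2 P b Q c := by
  unfold cSO
  simp only [latinPairs_option6, sec_inter, sec_ofSections_zero, sec_ofSections_one, sec_ofSections_two, inter_empty, latinPairs_empty_left]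
  ring

/-- Peeling an `I′`-literal of threshold `1` (`P ↦ ofSections ∅ P P`, `b ↦ ofSections ∅ b b`): weights `(0,2,2)` for `cSS, cSO`, `(2,1,1)` for `cOS, cOO`: the part `cOS`, weights `(2, 1, 1)`. [this work] -/
theorem cOS_primeP_one (F0 F1 F2 P b Q c : Finset (Pt κ)) :
    cOS (ofSections F0 F1 F2) (ofSections ∅ P P) (ofSections ∅ b b) (ofSections Q Q Q) (ofSections c c c) =
      2 * cOS F0 P b Q c + cOS F1 P b Q c + cOS F2 P b Q c := by
  unfold cOS
  simp only [latinPairs_option6, sec_inter, sec_ofSections_zero, sec_ofSections_one, sec_ofSections_two, latinPairs_empty_right]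
  ring

/-- Peeling an `I′`-literal of threshold `1` (`P ↦ ofSections ∅ P P`, `b ↦ ofSections ∅ b b`): weights `(0,2,2)` for `cSS, cSO`, `(2,1,1)` for `cOS, cOO`: the part `cOO`, weights `(2, 1, 1)`. [this work] -/
theorem cOO_primeP_one (F0 F1 F2 P b Q c : Finset (Pt κ)) :
    cOO (ofSections F0 F1 F2) (ofSections ∅ P P) (ofSections ∅ b b) (ofSections Q Q Q) (ofSections c c c) =
      2 * cOO F0 P b Q c + cOO F1 P b Q c + cOO F2 P b Q c := by
  unfold cOO
  simp only [latinPairs_option6, latinTriples_option6, sec_inter, sec_ofSections_zero, sec_ofSections_one, sec_ofSections_two, inter_empty, empty_inter, latinPairs_empty_right, latinTriples_empty_second]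
  ring

/-! ## §5  Lift by a `J′`-literal of threshold `2` (`Q ↦ ofSections ∅ ∅ Q`, `c ↦ ofSections ∅ ∅ c`; `P, b` cylinders) -/

/-- Peeling a `J′`-literal of threshold `2` (`Q ↦ ofSections ∅ ∅ Q`, `c ↦ ofSections ∅ ∅ c`; `P, b` cylinders): weights `(0,0,2)` for `cSS, cOS`, `(1,1,0)` for `cSO, cOO`: the part `cSS`, weights `(0, 0, 2)`. [this work] -/
theorem cSS_primeQ_two (F0 F1 F2 P b Q c : Finset (Pt κ)) :
    cSS (ofSections F0 F1 F2) (ofSections P P P) (ofSections b b b) (ofSections ∅ ∅ Q) (ofSections ∅ ∅ c) =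
      2 * cSS F2 P b Q c := by
  unfold cSS
  simp only [S1_option3, sec_inter, sec_ofSections_zero, sec_ofSections_one, sec_ofSections_two, inter_empty, empty_inter, S1_empty]
  ring

/-- Peeling a `J′`-literal of threshold `2` (`Q ↦ ofSections ∅ ∅ Q`, `c ↦ ofSections ∅ ∅ c`; `P, b` cylinders): weights `(0,0,2)` for `cSS, cOS`, `(1,1,0)` for `cSO, cOO`: the part `cSO`, weights `(1, 1, 0)`. [this work] -/
theorem cSO_primeQ_two (F0 F1 F2 P b Q c : Finset (Pt κ)) :
    cSO (ofSections F0 F1 F2) (ofSections P P P) (ofSections b b b) (ofSections ∅ ∅ Q) (ofSections ∅ ∅ c) =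
      cSO F0 P b Q c + cSO F1 P b Q c := by
  unfold cSO
  simp only [latinPairs_option6, sec_inter, sec_ofSections_zero, sec_ofSections_one, sec_ofSections_two, latinPairs_empty_right]
  ring

/-- Peeling a `J′`-literal of threshold `2` (`Q ↦ ofSections ∅ ∅ Q`, `c ↦ ofSections ∅ ∅ c`; `P, b` cylinders): weights `(0,0,2)` for `cSS, cOS`, `(1,1,0)` for `cSO, cOO`: the part `cOS`, weights `(0, 0, 2)`. [this work] -/
theorem cOS_primeQ_two (F0 F1 F2 P b Q c : Finset (Pt κ)) :
    cOS (ofSections F0 F1 F2) (ofSections P P P) (ofSections b b b) (ofSections ∅ ∅ Q) (ofSections ∅ ∅ c) =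
      2 * cOS F2 P b Q c := by
  unfold cOS
  simp only [latinPairs_option6, sec_inter, sec_ofSections_zero, sec_ofSections_one, sec_ofSections_two, inter_empty, latinPairs_empty_left]
  ring

/-- Peeling a `J′`-literal of threshold `2` (`Q ↦ ofSections ∅ ∅ Q`, `c ↦ ofSections ∅ ∅ c`; `P, b` cylinders): weights `(0,0,2)` for `cSS, cOS`, `(1,1,0)` for `cSO, cOO`: the part `cOO`, weights `(1, 1, 0)`. [this work] -/
theorem cOO_primeQ_two (F0 F1 F2 P b Q c : Finset (Pt κ)) :
    cOO (ofSections F0 F1 F2) (ofSections P P P) (ofSections b b b) (ofSections ∅ ∅ Q) (ofSections ∅ ∅ c) =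
      cOO F0 P b Q c + cOO F1 P b Q c := by
  unfold cOO
  simp only [latinPairs_option6, latinTriples_option6, sec_inter, sec_ofSections_zero, sec_ofSections_one, sec_ofSections_two, inter_empty, empty_inter, latinPairs_empty_right, latinTriples_empty_third]
  ring

/-! ## §6  Lift by a `J′`-literal of threshold `1` (`Q ↦ ofSections ∅ Q Q`, `c ↦ ofSections ∅ c c`) -/

/-- Peeling a `J′`-literal of threshold `1` (`Q ↦ ofSections ∅ Q Q`, `c ↦ ofSections ∅ c c`): weights `(0,2,2)` for `cSS, cOS`, `(2,1,1)` for `cSO, cOO`: the part `cSS`, weights `(0, 2, 2)`. [this work] -/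
theorem cSS_primeQ_one (F0 F1 F2 P b Q c : Finset (Pt κ)) :
    cSS (ofSections F0 F1 F2) (ofSections P P P) (ofSections b b b) (ofSections ∅ Q Q) (ofSections ∅ c c) =
      2 * cSS F1 P b Q c + 2 * cSS F2 P b Q c := by
  unfold cSS
  simp only [S1_option3, sec_inter, sec_ofSections_zero, sec_ofSections_one, sec_ofSections_two, inter_empty, empty_inter, S1_empty]
  ring

/-- Peeling a `J′`-literal of threshold `1` (`Q ↦ ofSections ∅ Q Q`, `c ↦ ofSections ∅ c c`): weights `(0,2,2)` for `cSS, cOS`, `(2,1,1)` for `cSO, cOO`: the part `cSO`, weights `(2, 1, 1)`. [this work] -/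
theorem cSO_primeQ_one (F0 F1 F2 P b Q c : Finset (Pt κ)) :
    cSO (ofSections F0 F1 F2) (ofSections P P P) (ofSections b b b) (ofSections ∅ Q Q) (ofSections ∅ c c) =
      2 * cSO F0 P b Q c + cSO F1 P b Q c + cSO F2 P b Q c := by
  unfold cSO
  simp only [latinPairs_option6, sec_inter, sec_ofSections_zero, sec_ofSections_one, sec_ofSections_two, latinPairs_empty_right]
  ring

/-- Peeling a `J′`-literal of threshold `1` (`Q ↦ ofSections ∅ Q Q`, `c ↦ ofSections ∅ c c`): weights `(0,2,2)` for `cSS, cOS`, `(2,1,1)` for `cSO, cOO`: the part `cOS`, weights `(0, 2, 2)`. [this work] -/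
theorem cOS_primeQ_one (F0 F1 F2 P b Q c : Finset (Pt κ)) :
    cOS (ofSections F0 F1 F2) (ofSections P P P) (ofSections b b b) (ofSections ∅ Q Q) (ofSections ∅ c c) =
      2 * cOS F1 P b Q c + 2 * cOS F2 P b Q c := by
  unfold cOS
  simp only [latinPairs_option6, sec_inter, sec_ofSections_zero, sec_ofSections_one, sec_ofSections_two, inter_empty, latinPairs_empty_left]
  ring

/-- Peeling a `J′`-literal of threshold `1` (`Q ↦ ofSections ∅ Q Q`, `c ↦ ofSections ∅ c c`): weights `(0,2,2)` for `cSS, cOS`, `(2,1,1)` for `cSO, cOO`: the part `cOO`, weights `(2, 1, 1)`. [this work] -/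
theorem cOO_primeQ_one (F0 F1 F2 P b Q c : Finset (Pt κ)) :
    cOO (ofSections F0 F1 F2) (ofSections P P P) (ofSections b b b) (ofSections ∅ Q Q) (ofSections ∅ c c) =
      2 * cOO F0 P b Q c + cOO F1 P b Q c + cOO F2 P b Q c := by
  unfold cOO
  simp only [latinPairs_option6, latinTriples_option6, sec_inter, sec_ofSections_zero, sec_ofSections_one, sec_ofSections_two, inter_empty, empty_inter, latinPairs_empty_right, latinTriples_empty_third]
  ring

end Summit.CriticalPhenomena.PercolationContinuityZ3.Theorems.SahiLatin
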